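import Literature.NumberTheory.GaloisRepresentations.LubinTateColemanRelativeProductTwo
import HarnessLib

/-!
# Zeros of `𝒪_E`-power series near the unit circle (`E` unramified) and uniqueness of the relative Coleman series

De Shalit, *Iwasawa theory of elliptic curves with complex multiplication* (1987), Ch. I §2.2, Theorem, uniqueness half
("the Weierstrass preparation theorem shows that `g = g_β` is unique"; also Cor. 2.3 (ii): "`g_β^φ − 𝒩_f g_β` has infinitely
many zeroes, so must be identically `0`"), in the RELATIVE situation: the coefficients live in `𝒪_E` for a finite
`E ⊆ F^{nr} = maxUnramified F` (so `𝔪_E = π𝒪_E`), and the series is evaluated after TWISTING its coefficients by ring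
endomorphisms `ψ` of `𝒪_E` fixing `π` and preserving absolute values (the powers `φ^{-i}` of the Frobenius in
`(φ^{-i} g)(ω_i) = β_i`).  This is the `𝒪_E`-version of the tree's `LubinTateColemanZeros` (base `𝒪_F`).  All PROVED:

* `exists_not_pow_dvd_unitBall`, `dvd_of_norm_ne_one` — `𝒪_E` bookkeeping (`E ⊆ F^{nr}`: a non-zero element is not
  divisible by every `π^k`; a non-unit is divisible by `π`).
* ★ `exists_eq_C_pow_mul_unitBall` — **`π`-content and Weierstrass degree**: a non-zero `d ∈ 𝒪_E⟦X⟧` is `π^a · d₀` with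
  `‖(d₀)_s‖ = 1` and `π ∣ (d₀)_k` for `k < s`.
* `norm_evS_map_map_eq_of_dominant` — for such `d₀`, a twist `ψ` (`ψ(π) = π`, `‖ψ c‖ = ‖c‖`), `E ≤ E'` and a point `x` of
  `𝔪_{E'}` with `‖π‖ < ‖x‖^s`: **`‖(ψ d₀)^ι(x)‖ = ‖x‖^s`**; hence ★ `exists_forall_evS_map_map_ne_zero` — **a non-zero `d` has,
  uniformly in the twist `ψ`, no zeros at points `x` with `‖π‖ < ‖x‖^N`**.
* ★★ `eq_zero_of_frequently_evS_map_map_eq_zero` — **uniqueness of the relative Coleman power series**: if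
  `(ψ_n d)^ι([u_n] λ'_{n+1}) = 0` in `E·K_π^{n+1}` for infinitely many `n` (`u_n` units, `ψ_n` twists), then `d = 0`;
  two-series form `eq_of_frequently_evS_map_map_eq`.

## References

* E. de Shalit, *Iwasawa theory of elliptic curves with complex multiplication* (1987), Ch. I §2.2 Theorem (uniqueness),
  Cor. 2.3 (ii). [deShalit1987]
* L. Washington, *Introduction to Cyclotomic Fields* (1997), §7.1 (Thm. 7.3, proof). [Washington1997]

## Tree reuse

`norm_aeval_eq_of_dominant`, `norm_ltSMul_of_isUnit`, `norm_pi_lt_norm_genPt_pow` (`LubinTateColemanZeros`),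
`exists_eq_algebraMap_mul_of_norm_lt_one`, `norm_algebraMap_pi_lt_one` (`LubinTateUnramifiedFrobenius`), `norm_inclUnitBall`,
`norm_algebraMap_LTCoeff`, `inclUnitBall_algebraMap_pi`, `inclPt_ltAct_eq_ltSMul`.
-/

noncomputable section

open Filter Topology
open scoped PowerSeries.WithPiTopology

namespace Literature.NumberTheory.GaloisRepresentations

section UnramifiedRelativeZeros

open GaloisRepresentations.IsNonarchimedeanLocalField LubinTate ValuativeRel Field

variable (F : Type*) [Field F] [ValuativeRel F] [TopologicalSpace F] [IsNonarchimedeanLocalField F]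

attribute [local instance] ltNormUniformSpace ltNormIsUniformAddGroup rk1 nF nE fintypeResidueField

variable {F}
variable {π : 𝒪[F]} (hπ : (valuation F).IsUniformizer (π : F))
variable (E : IntermediateField F (AlgebraicClosure F)) [FiniteDimensional F E]

/-! ### `𝒪_E` bookkeeping for `E ⊆ F^{nr}` -/

include hπ in
/-- A non-zero element of `𝒪_E` is not divisible by all powers of `π` (`‖π^k c‖ ≤ ‖π‖^k → 0`).
[cite: SerreLocalFields1979, Ch. II §2 Cor. 3] -/
theorem exists_not_pow_dvd_unitBall {c : unitBall E} (hc : c ≠ 0) :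
    ∃ k : ℕ, ¬ algebraMap 𝒪[F] (unitBall E) π ^ k ∣ c := by
  by_contra h
  push Not at h
  have hcpos : 0 < ‖(c : E)‖ := norm_pos_iff.mpr fun h0 => hc (Subtype.ext h0)
  obtain ⟨k, hk⟩ := exists_pow_lt_of_lt_one hcpos (norm_algebraMap_pi_lt_one hπ E)
  obtain ⟨y, hy⟩ := h k
  have hle : ‖(c : E)‖ ≤ ‖((algebraMap 𝒪[F] (unitBall E) π : unitBall E) : E)‖ ^ k := by
    rw [hy, Subring.coe_mul, SubmonoidClass.coe_pow, norm_mul, norm_pow]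
    calc _ ≤ ‖((algebraMap 𝒪[F] (unitBall E) π : unitBall E) : E)‖ ^ k * 1 := by gcongr; exact norm_coe_unitBall_le _
      _ = _ := mul_one _
  exact absurd (hk.trans_le hle) (lt_irrefl _)

include hπ in
/-- For `E ⊆ F^{nr}`: an element of `𝒪_E` of norm `≠ 1` is divisible by `π` (`𝔪_E = π𝒪_E`).
[cite: SerreLocalFields1979, Ch. IV §4 Cor. 2 to Prop. 16] -/
theorem dvd_of_norm_ne_one (hE : E ≤ maxUnramified F) {c : unitBall E} (hc : ‖(c : E)‖ ≠ 1) :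
    algebraMap 𝒪[F] (unitBall E) π ∣ c := by
  have hlt : ‖(c : E)‖ < 1 := lt_of_le_of_ne (norm_coe_unitBall_le _) hc
  obtain ⟨y, hy⟩ := exists_eq_algebraMap_mul_of_norm_lt_one hπ E hE hlt
  exact ⟨y, hy⟩

include hπ in
/-- ★ **`π`-content and Weierstrass degree over `𝒪_E`** (`E ⊆ F^{nr}`): a non-zero `d ∈ 𝒪_E⟦X⟧` is `π^a · d₀` where, for
some `s`, the degree-`s` coefficient of `d₀` has norm `1` and the lower coefficients are divisible by `π`.
[cite: Washington1997, §7.1 (Thm. 7.3, proof)] -/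
theorem exists_eq_C_pow_mul_unitBall (hE : E ≤ maxUnramified F) {d : PowerSeries (unitBall E)} (hd : d ≠ 0) :
    ∃ (a s : ℕ) (d₀ : PowerSeries (unitBall E)), d = PowerSeries.C (algebraMap 𝒪[F] (unitBall E) π ^ a) * d₀ ∧
      ‖((PowerSeries.coeff s d₀ : unitBall E) : E)‖ = 1 ∧
      ∀ k < s, algebraMap 𝒪[F] (unitBall E) π ∣ PowerSeries.coeff k d₀ := by
  classical
  set p : unitBall E := algebraMap 𝒪[F] (unitBall E) π with hp
  -- some coefficient is not divisible by some power of `π`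
  have hex : ∃ a : ℕ, ∃ k : ℕ, ¬ p ^ (a + 1) ∣ PowerSeries.coeff k d := by
    obtain ⟨k, hk⟩ : ∃ k, PowerSeries.coeff k d ≠ 0 := by
      by_contra h
      push Not at h
      exact hd (PowerSeries.ext fun k => by rw [h k, map_zero])
    obtain ⟨j, hj⟩ := exists_not_pow_dvd_unitBall hπ E hk
    rcases j with _ | j
    · exact (hj (by rw [pow_zero]; exact one_dvd _)).elim
    · exact ⟨j, k, hj⟩
  let a := Nat.find hex
  have ha : ∃ k, ¬ p ^ (a + 1) ∣ PowerSeries.coeff k d := Nat.find_spec hex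
  have hmin : ∀ k, p ^ a ∣ PowerSeries.coeff k d := by
    intro k
    rcases Nat.eq_zero_or_pos a with h0 | hpos
    · rw [h0, pow_zero]; exact one_dvd _
    · by_contra hk
      have : a - 1 < a := Nat.sub_lt hpos one_pos
      exact Nat.find_min hex this ⟨k, by rwa [Nat.sub_add_cancel hpos]⟩
  choose e he using hmin
  set d₀ : PowerSeries (unitBall E) := PowerSeries.mk e with hd₀
  have hdd : d = PowerSeries.C (p ^ a) * d₀ := by
    refine PowerSeries.ext fun k => ?_
    rw [PowerSeries.coeff_C_mul, hd₀, PowerSeries.coeff_mk]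
    exact he k
  have hcoeff : ∀ k, PowerSeries.coeff k d₀ = e k := fun k => by rw [hd₀, PowerSeries.coeff_mk]
  -- a coefficient of `d₀` has norm `1`
  have hunit : ∃ s, ‖((PowerSeries.coeff s d₀ : unitBall E) : E)‖ = 1 := by
    obtain ⟨k, hk⟩ := ha
    refine ⟨k, ?_⟩
    by_contra hnu
    obtain ⟨c, hc⟩ := dvd_of_norm_ne_one hπ E hE hnu
    apply hk
    refine ⟨c, ?_⟩
    rw [he k, ← hcoeff, hc, pow_succ, mul_assoc]
  refine ⟨a, Nat.find hunit, d₀, hdd, Nat.find_spec hunit, fun k hk => ?_⟩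
  exact dvd_of_norm_ne_one hπ E hE (Nat.find_min hunit hk)

/-! ### Values at points close to the unit circle, uniformly in a twist of the coefficients -/

variable {E}

/-- **`‖(ψ d₀)^ι(x)‖ = ‖x‖^s`** when the degree-`s` coefficient of `d₀ ∈ 𝒪_E⟦X⟧` has norm `1`, the lower ones are divisible by
`π`, `ψ` is a ring endomorphism of `𝒪_E` fixing `π` and preserving absolute values (a "twist", e.g. a power of the Frobenius),
`E ≤ E'` and `x ∈ 𝔪_{E'}` with `‖π‖ < ‖x‖^s` (dominant term). [cite: deShalit1987, Ch. I §2.2 Theorem (proof, uniqueness)] -/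
theorem norm_evS_map_map_eq_of_dominant {E' : IntermediateField F (AlgebraicClosure F)} [FiniteDimensional F E']
    (h : E ≤ E') {ψ : unitBall E →+* unitBall E}
    (hψn : ∀ c : unitBall E, ‖((ψ c : unitBall E) : E)‖ = ‖(c : E)‖)
    {d₀ : PowerSeries (unitBall E)} {s : ℕ} (hs : ‖((PowerSeries.coeff s d₀ : unitBall E) : E)‖ = 1)
    (hlow : ∀ k < s, algebraMap 𝒪[F] (unitBall E) π ∣ PowerSeries.coeff k d₀)
    (x : (maxNilIdeal F E').toIdeal) (hx : ‖(π : F)‖ < ‖((x : unitBall E') : E')‖ ^ s) :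
    ‖((evS (maxNilIdeal F E') x (PowerSeries.map (inclUnitBall (F := F) h : unitBall E →+* unitBall E')
        (PowerSeries.map ψ d₀)) : unitBall E') : E')‖ = ‖((x : unitBall E') : E')‖ ^ s := by
  have hx1 : ‖((x : unitBall E') : E')‖ < 1 := x.2
  change ‖((PowerSeries.aeval (isTopologicallyNilpotent_of_norm_lt_one E' hx1) (PowerSeries.map
    (inclUnitBall (F := F) h : unitBall E →+* unitBall E') (PowerSeries.map ψ d₀)) : unitBall E') : E')‖ = _
  refine norm_aeval_eq_of_dominant _ hx1 ?_ (c := ‖(π : F)‖) ?_ hx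
  · rw [PowerSeries.coeff_map, PowerSeries.coeff_map]
    change ‖((inclUnitBall (F := F) h (ψ (PowerSeries.coeff s d₀)) : unitBall E') : E')‖ = 1
    rw [norm_inclUnitBall, hψn, hs]
  · intro k hk
    rw [PowerSeries.coeff_map, PowerSeries.coeff_map]
    change ‖((inclUnitBall (F := F) h (ψ (PowerSeries.coeff k d₀)) : unitBall E') : E')‖ ≤ _
    obtain ⟨c, hc⟩ := hlow k hk
    rw [norm_inclUnitBall, hψn, hc, Subring.coe_mul, norm_mul]
    calc _ ≤ ‖((algebraMap 𝒪[F] (unitBall E) π : unitBall E) : E)‖ * 1 := by gcongr; exact norm_coe_unitBall_le _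
      _ = ‖(π : F)‖ := by rw [mul_one]; exact norm_algebraMap_LTCoeff E π

include hπ in
/-- ★ **A non-zero `d ∈ 𝒪_E⟦X⟧` has no zeros close to the unit circle, uniformly in twists**: there is `N` (the Weierstrass
degree of `d/π^a`) such that `(ψ d)^ι(x) ≠ 0` for every twist `ψ` (`ψ(π) = π`, `‖ψ c‖ = ‖c‖`), every finite `E' ≥ E` and every
point `x ∈ 𝔪_{E'}` with `‖π‖ < ‖x‖^N`; quantitatively `‖(ψ d)^ι(x)‖ = ‖π‖^a ‖x‖^N`.
[cite: deShalit1987, Ch. I §2.2 Theorem (proof, uniqueness)] -/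
theorem exists_forall_norm_evS_map_map_eq (hE : E ≤ maxUnramified F) {d : PowerSeries (unitBall E)} (hd : d ≠ 0) :
    ∃ a N : ℕ, ∀ (ψ : unitBall E →+* unitBall E),
      ψ (algebraMap 𝒪[F] (unitBall E) π) = algebraMap 𝒪[F] (unitBall E) π →
      (∀ c : unitBall E, ‖((ψ c : unitBall E) : E)‖ = ‖(c : E)‖) →
      ∀ (E' : IntermediateField F (AlgebraicClosure F)) [FiniteDimensional F E'] (h : E ≤ E')
        (x : (maxNilIdeal F E').toIdeal), ‖(π : F)‖ < ‖((x : unitBall E') : E')‖ ^ N →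
        ‖((evS (maxNilIdeal F E') x (PowerSeries.map (inclUnitBall (F := F) h : unitBall E →+* unitBall E')
            (PowerSeries.map ψ d)) : unitBall E') : E')‖ = ‖(π : F)‖ ^ a * ‖((x : unitBall E') : E')‖ ^ N := by
  obtain ⟨a, s, d₀, rfl, hs, hlow⟩ := exists_eq_C_pow_mul_unitBall hπ E hE hd
  refine ⟨a, s, fun ψ hψπ hψn E' _ h x hx => ?_⟩
  have e1 : (inclUnitBall (F := F) h : unitBall E →+* unitBall E') (algebraMap 𝒪[F] (unitBall E) π) =
      algebraMap 𝒪[F] (unitBall E') π := inclUnitBall_algebraMap_pi h π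
  rw [map_mul, map_mul, map_mul, Subring.coe_mul, norm_mul, norm_evS_map_map_eq_of_dominant h hψn hs hlow x hx,
    PowerSeries.map_C, PowerSeries.map_C, evS_C, map_pow, map_pow, hψπ, e1, SubmonoidClass.coe_pow, norm_pow]
  congr 2
  exact norm_algebraMap_LTCoeff E' π

/-! ### Application to the division points: uniqueness of the relative Coleman power series -/

include hπ in
/-- The level index `(q-1)qⁿ` tends to infinity: `N < (q-1)qⁿ` for `n ≥ N`. [cite: CasselsFrohlichANT1967, Ch. VI §3.6 Cor.] -/
theorem lt_index_of_le' {N n : ℕ} (hn : N ≤ n) : N < (residueFieldCard F - 1) * residueFieldCard F ^ n := by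
  have hπ' := hπ
  have hq : 1 < residueFieldCard F := one_lt_residueFieldCard F
  have h1 : n < residueFieldCard F ^ n := Nat.lt_pow_self hq
  have h2 : residueFieldCard F ^ n ≤ (residueFieldCard F - 1) * residueFieldCard F ^ n :=
    Nat.le_mul_of_pos_left _ (by omega)
  omega

include hπ in
/-- ★★ **Uniqueness of the relative Coleman power series** (de Shalit I §2.2, relative situation; `E ⊆ F^{nr}` finite): if
`d ∈ 𝒪_E⟦X⟧` satisfies `(ψ_n d)^ι([u_n] λ'_{n+1}) = 0` in `E·K_π^{n+1}` for infinitely many `n` — `u_n ∈ 𝒪_F^×`, `ψ_n` twists of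
`𝒪_E` (`ψ_n(π) = π`, `‖ψ_n c‖ = ‖c‖`, e.g. `φ^{-(n+1)}`) — then `d = 0` (`‖[u_n]λ_{n+1}‖^N > ‖π‖` for `n` large).
[cite: deShalit1987, Ch. I §2.2 Theorem (uniqueness)] -/
theorem eq_zero_of_frequently_evS_map_map_eq_zero (hE : E ≤ maxUnramified F) {d : PowerSeries (unitBall E)}
    (ψ : ℕ → (unitBall E →+* unitBall E))
    (hψπ : ∀ n, ψ n (algebraMap 𝒪[F] (unitBall E) π) = algebraMap 𝒪[F] (unitBall E) π)
    (hψn : ∀ n (c : unitBall E), ‖((ψ n c : unitBall E) : E)‖ = ‖(c : E)‖)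
    (u : ℕ → 𝒪[F]) (hu : ∀ n, IsUnit (u n))
    (h : ∃ᶠ n in atTop, evS (maxNilIdeal F (E ⊔ ltField π n : IntermediateField F (AlgebraicClosure F)))
      (inclPt (le_sup_right : ltField π n ≤ E ⊔ ltField π n) (ltAct hπ n (u n) (genPt hπ n)))
      (PowerSeries.map (inclUnitBall (F := F) (le_sup_left : E ≤ E ⊔ ltField π n) :
        unitBall E →+* unitBall (E ⊔ ltField π n : IntermediateField F (AlgebraicClosure F))) (PowerSeries.map (ψ n) d)) = 0) :
    d = 0 := by
  by_contra hd
  obtain ⟨a, N, hN⟩ := exists_forall_norm_evS_map_map_eq hπ hE hd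
  obtain ⟨n, hzero, hn⟩ := (h.and_eventually (eventually_ge_atTop N)).exists
  have hx : ‖(π : F)‖ < ‖((((inclPt (le_sup_right : ltField π n ≤ E ⊔ ltField π n) (ltAct hπ n (u n) (genPt hπ n))) :
      (maxNilIdeal F (E ⊔ ltField π n : IntermediateField F (AlgebraicClosure F))).toIdeal) :
      unitBall (E ⊔ ltField π n : IntermediateField F (AlgebraicClosure F))) :
      (E ⊔ ltField π n : IntermediateField F (AlgebraicClosure F)))‖ ^ N := by
    change ‖(π : F)‖ < ‖((inclUnitBall (F := F) (le_sup_right : ltField π n ≤ E ⊔ ltField π n)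
      ((ltAct hπ n (u n) (genPt hπ n) : (maxNilIdeal F (ltField π n)).toIdeal) : unitBall (ltField π n)) :
      unitBall (E ⊔ ltField π n : IntermediateField F (AlgebraicClosure F))) :
      (E ⊔ ltField π n : IntermediateField F (AlgebraicClosure F)))‖ ^ N
    rw [norm_inclUnitBall, ltAct, norm_ltSMul_of_isUnit hπ (ltField π n) (hu n)]
    exact norm_pi_lt_norm_genPt_pow hπ n (lt_index_of_le' hπ hn)
  have h1 := hN (ψ n) (hψπ n) (hψn n) _ le_sup_left _ hx
  rw [hzero, ZeroMemClass.coe_zero, norm_zero] at h1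
  have hπpos : 0 < ‖(π : F)‖ := norm_pos_iff.mpr hπ.ne_zero
  exact absurd h1.symm (mul_pos (pow_pos hπpos _) (hπpos.trans hx)).ne'

include hπ in
/-- **Uniqueness, two-series form**: two series in `𝒪_E⟦X⟧` whose twists take the same value at a primitive point of
`E·K_π^{n+1}` for infinitely many `n` are equal. [cite: deShalit1987, Ch. I §2.2 Theorem (uniqueness)] -/
theorem eq_of_frequently_evS_map_map_eq (hE : E ≤ maxUnramified F) {g g' : PowerSeries (unitBall E)}
    (ψ : ℕ → (unitBall E →+* unitBall E))
    (hψπ : ∀ n, ψ n (algebraMap 𝒪[F] (unitBall E) π) = algebraMap 𝒪[F] (unitBall E) π)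
    (hψn : ∀ n (c : unitBall E), ‖((ψ n c : unitBall E) : E)‖ = ‖(c : E)‖)
    (u : ℕ → 𝒪[F]) (hu : ∀ n, IsUnit (u n))
    (h : ∃ᶠ n in atTop, evS (maxNilIdeal F (E ⊔ ltField π n : IntermediateField F (AlgebraicClosure F)))
      (inclPt (le_sup_right : ltField π n ≤ E ⊔ ltField π n) (ltAct hπ n (u n) (genPt hπ n)))
      (PowerSeries.map (inclUnitBall (F := F) (le_sup_left : E ≤ E ⊔ ltField π n) :
        unitBall E →+* unitBall (E ⊔ ltField π n : IntermediateField F (AlgebraicClosure F))) (PowerSeries.map (ψ n) g)) =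
      evS (maxNilIdeal F (E ⊔ ltField π n : IntermediateField F (AlgebraicClosure F)))
      (inclPt (le_sup_right : ltField π n ≤ E ⊔ ltField π n) (ltAct hπ n (u n) (genPt hπ n)))
      (PowerSeries.map (inclUnitBall (F := F) (le_sup_left : E ≤ E ⊔ ltField π n) :
        unitBall E →+* unitBall (E ⊔ ltField π n : IntermediateField F (AlgebraicClosure F))) (PowerSeries.map (ψ n) g'))) :
    g = g' := by
  rw [← sub_eq_zero]
  refine eq_zero_of_frequently_evS_map_map_eq_zero hπ hE ψ hψπ hψn u hu (h.mono fun n hn => ?_)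
  rw [map_sub, map_sub, map_sub, hn, sub_self]

end UnramifiedRelativeZeros

end Literature.NumberTheory.GaloisRepresentations
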